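import Literature.NumberTheory.Automorphic.HilbertPartialHasseWeightShiftingProofs
import Literature.NumberTheory.LFunctions.CubicRayClassCharacterCount
import Literature.NumberTheory.EllipticCurves.SelmerInertiaProofs
import Literature.NumberTheory.EllipticCurves.EisensteinNewformLevelRaisingDeligneSerreLiftProofs
import Summits.BirchSwinnertonDyer.BirchSwinnertonDyer.Theorems.ResidualThetaTransportAtTwoHeckeThetaPartnerAdicAtTwoTeichmullerTwistPrelim
import Summits.BirchSwinnertonDyer.BirchSwinnertonDyer.Theorems.ResidualThetaTransportAtTwoThetaLayerLambdaCongruenceAtTwoLayerLambdaStable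
import HarnessLib

/-!
# Matching the cubic character with the embedding at the inert prime `2` — preliminaries

Route `ResidualThetaTransportAtTwo`, crux K0⁺ `HeckeThetaPartnerAdicAtTwo` (stmt-BirchSwinnertonDyer-20690),
helper §D1 of the line "proof from print".  THEOREMS ONLY (no definition, no named fact, no `sorry`).

Setting: `k` a quadratic field in which `2` is inert (`P = (2)` prime, `𝓞_k/P ≅ 𝔽₄`), `e : ℚ̄₂ ≃ ℂ`,
`σ : k → ℂ`, an odd modulus `𝔪` (coprime to `P`), and a "cubic" multiplicative function `ψ` on the
primes: a ray class character modulo some `𝔪_χ ⊇ (2ᵃ)·𝔪` whose values at the primes `≠ P`, `∤ 𝔪` are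
cube roots of unity (the prime-value function of the cubic Hecke character of `ℚ(W[2])/k`).  Write
`S = {b ∈ 𝓞_k : b ≠ 0 odd, b ≡ 1 mod 𝔪}` and read complex numbers `2`-adically through `e`.

**Main result** `exists_matching_pow`: if `ψ̃((b₀)) ≠ 1` for SOME `b₀ ∈ S` (the cubic character is
ramified at `2`, helper §D2), then for `ε = 1` or `ε = 2` and EVERY `b ∈ S`:
`ψ̃((b))^ε ≡ σ(b)` modulo the maximal ideal of `ℤ̄₂` (`‖e⁻¹(ψ̃((b))^ε) - e⁻¹(σ b)‖ < 1`) — the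
MATCHING CONDITION of the Teichmüller twist (`…TeichmullerTwist.exists_isGrossencharakter_congr`) for
`χ^ε`.  Proof (the "canonical character at `2`"): both `F(b) = ψ̃((b)) mod 𝔪_{ℤ̄₂}` and
`G(b) = σ(b) mod 𝔪_{ℤ̄₂}` are multiplicative on `S` and trivial on `b ≡ 1 mod 2` (`F`: `b^{2ᵃ} ≡ 1 mod 𝔪_χ`
and `F³ = 1`; `G`: `σ(1 + 2c) ≡ 1`), so both factor through `(𝓞_k/2)ˣ ≅ ℤ/3`, generated by the class of
`b₀`; `g = G(b₀)` is a primitive cube root of unity in `𝔽̄₂` (`b₀ ≢ 1 mod 2`), the cube roots of unity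
there are `1, g, g²`, and `u = F(b₀) ≠ 1` is one of them: `u = g` gives `ε = 1`, `u = g²` gives `ε = 2`.

References: Serre, *Propriétés galoisiennes des points d'ordre fini des courbes elliptiques*, Invent.
Math. 15 (1972) §1–2 (fundamental characters of level `2` at a supersingular prime); Rohrlich,
Invent. Math. 75 (1984) (canonical Hecke characters).  Only the elementary `(𝓞_k/2)ˣ` bookkeeping is
formalised here.
-/

set_option autoImplicit false
set_option linter.dupNamespace false

noncomputable section

open scoped NumberField
open NumberField IsDedekindDomain IsLocalRing
open Literature.NumberTheory.GaloisRepresentations Literature.NumberTheory.LFunctions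
  Literature.NumberTheory.Automorphic Literature.NumberTheory.EllipticCurves.ModularForms
  Summit.BirchSwinnertonDyer.BirchSwinnertonDyer.Theorems.ThetaLayerLambdaCongruenceAtTwo

namespace Summit.BirchSwinnertonDyer.BirchSwinnertonDyer.Theorems.HeckeThetaPartner

/-! ### `2`-adic sizes of algebraic integers along `e : ℚ̄₂ ≃ ℂ` -/

section Adic

variable {k : Type} [Field k] [NumberField k] {p : ℕ} [Fact p.Prime]

omit [NumberField k] in
/-- Algebraic integers of `k` are `e`-adically integral. [folklore] -/
theorem norm_symm_embedding_le_one (e : PadicAlgCl p ≃+* ℂ) (σ : k →+* ℂ) (x : 𝓞 k) :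
    ‖e.symm (σ (x : k))‖ ≤ 1 := by
  refine PadicAlgCl.norm_le_one_of_isIntegral (p := p) ?_
  have hx : IsIntegral ℤ (x : k) := RingOfIntegers.isIntegral_coe x
  exact hx.map (((e.symm : ℂ ≃+* PadicAlgCl p) : ℂ →+* PadicAlgCl p).comp σ).toIntAlgHom

/-- In a commutative ring: `x ≡ 1 mod 2 ⟹ x^{2ⁿ} ≡ 1 mod 2ⁿ⁺¹`. [folklore] -/
theorem pow_two_pow_sub_one_mem {R : Type*} [CommRing R] {x : R} (hx : x - 1 ∈ Ideal.span {(2 : R)})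
    (n : ℕ) : x ^ 2 ^ n - 1 ∈ Ideal.span {(2 : R) ^ (n + 1)} := by
  induction n with
  | zero => simpa using hx
  | succ n ih =>
    have h1 : x ^ 2 ^ (n + 1) - 1 = (x ^ 2 ^ n - 1) * ((x ^ 2 ^ n - 1) + 2) := by ring
    have h2 : (x ^ 2 ^ n - 1) + 2 ∈ Ideal.span {(2 : R)} := by
      refine (Ideal.span {(2 : R)}).add_mem ?_ (Ideal.mem_span_singleton_self _)
      have hle : Ideal.span {(2 : R) ^ (n + 1)} ≤ Ideal.span {(2 : R)} :=
        Ideal.span_singleton_le_span_singleton.mpr (dvd_pow_self 2 (Nat.succ_ne_zero n))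
      exact hle ih
    have h3 := Ideal.mul_mem_mul ih h2
    rw [Ideal.span_singleton_mul_span_singleton, ← pow_succ, ← h1] at h3
    exact h3

variable (e : PadicAlgCl 2 ≃+* ℂ) (σ : k →+* ℂ)

/-- `σ(x) ≡ 1` (`2`-adically) for `x ≡ 1 mod 2𝓞_k`. [folklore] -/
theorem norm_symm_embedding_sub_one_lt_one {x : 𝓞 k} (hx : x - 1 ∈ Ideal.span {(2 : 𝓞 k)}) :
    ‖e.symm (σ (x : k)) - 1‖ < 1 := by
  obtain ⟨w, hw⟩ := Ideal.mem_span_singleton.mp hx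
  have hx' : algebraMap (𝓞 k) k x = 1 + 2 * algebraMap (𝓞 k) k w := by
    have := congrArg (algebraMap (𝓞 k) k) hw
    rw [map_sub, map_one, map_mul, map_ofNat] at this
    linear_combination this
  change ‖e.symm (σ (algebraMap (𝓞 k) k x)) - 1‖ < 1
  have h : e.symm (σ (algebraMap (𝓞 k) k x)) - 1 = 2 * e.symm (σ (algebraMap (𝓞 k) k w)) := by
    rw [hx', map_add, map_mul, map_one, map_add, map_mul, map_one, map_ofNat, map_ofNat]
    ring
  rw [h, norm_mul]
  have h2 : ‖(2 : PadicAlgCl 2)‖ < 1 := by exact_mod_cast PadicAlgCl.norm_natCast_p_lt_one (p := 2)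
  exact (mul_le_of_le_one_right (norm_nonneg _) (norm_symm_embedding_le_one e σ w)).trans_lt h2

/-- `σ(y)` is a `2`-adic unit for `y ∉ 2𝓞_k`, when `(2)` is prime: `y z = 1 + 2w` for some `z, w`.
[folklore] -/
theorem norm_symm_embedding_eq_one_of_not_mem (hp : (Ideal.span {(2 : 𝓞 k)}).IsPrime) {y : 𝓞 k}
    (hy : y ∉ Ideal.span {(2 : 𝓞 k)}) : ‖e.symm (σ (y : k))‖ = 1 := by
  set P := Ideal.span {(2 : 𝓞 k)} with hPdef
  have hP0 : P ≠ ⊥ := by rw [hPdef, Ne, Ideal.span_singleton_eq_bot]; norm_num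
  haveI : P.IsMaximal := hp.isMaximal hP0
  letI : Field (𝓞 k ⧸ P) := Ideal.Quotient.field P
  -- `y` is invertible mod `P`
  have hunit : IsUnit (Ideal.Quotient.mk P y) :=
    Ne.isUnit (by rw [Ne, Ideal.Quotient.eq_zero_iff_mem]; exact hy)
  obtain ⟨z', hz'⟩ := hunit.exists_right_inv
  obtain ⟨z, rfl⟩ := Ideal.Quotient.mk_surjective z'
  rw [← map_mul, ← map_one (Ideal.Quotient.mk P), Ideal.Quotient.eq] at hz'
  have hlt := norm_symm_embedding_sub_one_lt_one e σ hz'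
  have hyz : e.symm (σ ((y * z : 𝓞 k) : k)) = e.symm (σ (y : k)) * e.symm (σ (z : k)) := by
    push_cast; rw [map_mul, map_mul]
  rw [hyz] at hlt
  -- `‖σ y‖ ‖σ z‖ = 1`
  have h1 : ‖e.symm (σ (y : k)) * e.symm (σ (z : k))‖ = 1 := by
    have h' : ‖(1 : PadicAlgCl 2) - e.symm (σ (y : k)) * e.symm (σ (z : k))‖ < ‖(1 : PadicAlgCl 2)‖ := by
      rw [norm_sub_rev, norm_one]; exact hlt
    rw [norm_eq_of_norm_sub_lt_norm h', norm_one]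
  rw [norm_mul] at h1
  have hy1 := norm_symm_embedding_le_one e σ y
  have hz1 := norm_symm_embedding_le_one e σ z
  by_contra hne
  have hlt' : ‖e.symm (σ (y : k))‖ < 1 := lt_of_le_of_ne hy1 hne
  have : ‖e.symm (σ (y : k))‖ * ‖e.symm (σ (z : k))‖ < 1 :=
    (mul_le_of_le_one_right (norm_nonneg _) hz1).trans_lt hlt'
  exact absurd h1 this.ne

end Adic

/-! ### Cube roots of unity -/

section CubeRoots

/-- A cube root of unity `ζ ≠ 1` in `ℂ` has `(1 - ζ)(1 - ζ²) = 3`. [folklore] -/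
theorem one_sub_mul_one_sub_sq_eq_three {ζ : ℂ} (h3 : ζ ^ 3 = 1) (h1 : ζ ≠ 1) :
    (1 - ζ) * (1 - ζ ^ 2) = 3 := by
  have hq : ζ ^ 2 + ζ + 1 = 0 := by
    have : (ζ - 1) * (ζ ^ 2 + ζ + 1) = 0 := by linear_combination h3
    exact (mul_eq_zero.mp this).resolve_left (sub_ne_zero.mpr h1)
  linear_combination h3 - hq

/-- A cube root of unity `ζ ≠ 1` is NOT congruent to `1` `2`-adically: `‖e⁻¹ζ - 1‖ = 1`
(`(1 - ζ)(1 - ζ²) = 3` is a `2`-adic unit and both factors are integral). [folklore] -/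
theorem norm_symm_sub_one_eq_one_of_pow_three (e : PadicAlgCl 2 ≃+* ℂ) {ζ : ℂ} (h3 : ζ ^ 3 = 1)
    (h1 : ζ ≠ 1) : ‖e.symm ζ - 1‖ = 1 := by
  have hζ : ‖e.symm ζ‖ = 1 := norm_symm_eq_one_of_pow_eq_one e (by norm_num : 0 < 3) h3
  have hζ2 : ‖e.symm (ζ ^ 2)‖ = 1 := by rw [map_pow, norm_pow, hζ, one_pow]
  have hprod := one_sub_mul_one_sub_sq_eq_three h3 h1
  have h3' : ‖((3 : ℤ) : PadicAlgCl 2)‖ = 1 :=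
    DeligneSerreLift.norm_intCast_eq_one_of_not_dvd (p := 2) (by norm_num)
  have hn : ‖e.symm (1 - ζ)‖ * ‖e.symm (1 - ζ ^ 2)‖ = 1 := by
    rw [← norm_mul, ← map_mul, hprod]
    have : e.symm 3 = ((3 : ℤ) : PadicAlgCl 2) := by push_cast; exact map_ofNat _ 3
    rw [this, h3']
  have hle : ∀ x : ℂ, ‖e.symm x‖ = 1 → ‖e.symm (1 - x)‖ ≤ 1 := by
    intro x hx
    rw [map_sub, map_one]
    refine (Literature.NumberTheory.EllipticCurves.norm_sub_le_max_of_isUltrametricDist _ _).trans ?_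
    rw [norm_one, hx, max_self]
  have hle1 := hle ζ hζ
  have hle2 := hle (ζ ^ 2) hζ2
  have heq : ‖e.symm (1 - ζ)‖ = 1 := by
    by_contra hne
    have hlt : ‖e.symm (1 - ζ)‖ < 1 := lt_of_le_of_ne hle1 hne
    have : ‖e.symm (1 - ζ)‖ * ‖e.symm (1 - ζ ^ 2)‖ < 1 :=
      (mul_le_of_le_one_right (norm_nonneg _) hle2).trans_lt hlt
    exact absurd hn this.ne
  rwa [map_sub, map_one, norm_sub_rev] at heq

/-- In a field, if `g ≠ 1` is a cube root of unity then every cube root of unity is `1`, `g` or `g²`.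
[folklore] -/
theorem eq_one_or_eq_or_eq_sq_of_pow_three {F : Type*} [Field F] {g u : F} (hg3 : g ^ 3 = 1)
    (hg1 : g ≠ 1) (hu : u ^ 3 = 1) : u = 1 ∨ u = g ∨ u = g ^ 2 := by
  have hs : 1 + g + g ^ 2 = 0 := by
    have : (g - 1) * (1 + g + g ^ 2) = 0 := by linear_combination hg3
    exact (mul_eq_zero.mp this).resolve_left (sub_ne_zero.mpr hg1)
  have hprod : (u - 1) * ((u - g) * (u - g ^ 2)) = 0 := by
    linear_combination hu - (u ^ 2 - u) * hs + (u - 1) * hg3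
  rcases mul_eq_zero.mp hprod with h | h
  · exact Or.inl (sub_eq_zero.mp h)
  · rcases mul_eq_zero.mp h with h | h
    · exact Or.inr (Or.inl (sub_eq_zero.mp h))
    · exact Or.inr (Or.inr (sub_eq_zero.mp h))

end CubeRoots

/-! ### No real embeddings -/

section Real

variable {k : Type} [Field k] [NumberField k]

omit [NumberField k] in
/-- A totally complex field has no real embedding. [folklore] -/
theorem false_of_ringHom_real [IsTotallyComplex k] (φ : k →+* ℝ) : False := by
  have hreal : ComplexEmbedding.IsReal ((algebraMap ℝ ℂ).comp φ) := by
    rw [ComplexEmbedding.isReal_iff]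
    ext x
    simp [ComplexEmbedding.conjugate_coe_eq]
  have h1 : (InfinitePlace.mk ((algebraMap ℝ ℂ).comp φ)).IsReal := ⟨_, hreal, rfl⟩
  exact InfinitePlace.not_isReal_iff_isComplex.mpr (IsTotallyComplex.isComplex _) h1

end Real

end Summit.BirchSwinnertonDyer.BirchSwinnertonDyer.Theorems.HeckeThetaPartner

end
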